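import Summits.QuantumFields.BalabanUV.Beta.EriceRemainderEnclosureHistoryAutonomyComparisonNonlinearModulus

/-!
# EriceRemainderEnclosureHistoryAutonomyComparisonAffineMonotone — (E119e) **THE AFFINE FLOW IS ANTITONE IN ALL ITS COEFFICIENTS.**  Two affine memories on the box
# ]0,γ], `B u = β₀ + Σ_{k<K} L_k·u_k` and `B′ u = β₁ + Σ_{k<K} L′_k·u_k`, with `0 < β₀ ≤ β₁`, `0 ≤ L_k ≤ L′_k`, `L_0 = L′_0 = 0` (the profiles, the range `K` and ALL
# SIZES ARBITRARY): ANY box solutions `h`, `h′` of `B`, `B′` from one pin satisfy **`h′ ≤ h` at EVERY scale** (**`le_of_affine_le`**) — raising the floor, raising any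
# weight, or ADDING AGES lowers the solution.  This is conjecture (E58′) of the comparison column for every AFFINE isotone excess `η₀ + Σ_k M_k·u_k`, at any size.
# PROOF: CHAINING.  The excess `E = B′ − B` is isotone with modulus `ME = Σ_k (L′_k − L_k)` along ordered pairs; split it into `N` equal parts with `(ME∕N)·γ ≤ β₀∕5`;
# every intermediate memory `B + (i∕N)·E` is again affine with floor `≥ β₀`, so (E119d) `le_of_small_modulus_excess` compares consecutive members of the chain of box
# solutions from the pin ((E39) existence, (E43b) uniqueness at the two ends), and the order is transitive.

Cell `pub-balaban`, β-function sub-cell, BINDER row D4 «RemainderConst leaves for Bałaban's split» (`HOME/BINDER-OWNERS.md`; owner lineage `b2b-balaban-beta-an4`;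
this file by co-owner #2 lineage `b2b-balaban-beta-d4-p2`, generation 98), β-FLOW TEAM duty (1), FREEZE (0) honoured (def-free; imports (E119d) `…NonlinearModulus`;
uses its `le_of_small_modulus_excess`, (E118a) `affine_facts`, (E39) `exists_memFlow_zm`, (E43b) `memFlow_unique_of_monotone_zm` BY NAME; nothing restated).

HONEST FRAMING (page 1, verbatim and binding).  *"Discharging BetaPertH makes Bałaban's UV stability UNCONDITIONAL — a real constructive-QFT result; it is
NOT the continuum limit and NOT the Clay problem."*  THIS FILE DISCHARGES NOTHING OF THE KIND.  Elementary real analysis about ABSTRACT functionals on a box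
]0,γ]^ℕ with displayed floors, profiles and signs — hypotheses of a census, not facts; the form, signs, ages and moments of Bałaban's (1.22) limit functional
(in particular whether it is affine in the history) are NOT PRINTED ([I] p. 298; GAPS G-t4-U2-1∕-2) and NOT asserted.  Row D4 class UNCHANGED (critical-path
width 0; instance 0∕1; D4 DISCHARGE NO DATE).  HONEST DEPENDENCY: continuum YM on T⁴ ⇐ BetaPertH ∧ nine spine estimates (0/9 proved); BetaPertH ⇐ (D1) ∧ (D4) ∧
CAP+tail; G-an2-4 gates asym, D1 and NE2/3/4.  NOT CLAIMED: non-affine excesses beyond (E119d), Markov weight, anything printed — NOT B12 Thm 2, NOT BetaPertH,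
NOT continuum, NOT Clay.

WHAT IS PROVED ([folklore]; 0 `def`, 0 sorry).  `affine_interp_facts`, **`le_of_affine_le`**.
-/

noncomputable section
open Finset Set

namespace Summit.QuantumFields.BalabanUV.Beta.EriceRemainderEnclosureHistoryAutonomyComparisonAffineMonotone

open Literature.MathematicalPhysics.QuantumFieldTheory.Balaban1983to89
open Literature.MathematicalPhysics.QuantumFieldTheory.Balaban1983to89.T4BetaStationary
open Literature.MathematicalPhysics.QuantumFieldTheory.Balaban1983to89.T4BetaFlowWellPosed
open Summit.QuantumFields.BalabanUV.Beta.EriceRemainderEnclosureHistoryAutonomyExistence (exists_memFlow_zm)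
open Summit.QuantumFields.BalabanUV.Beta.EriceRemainderEnclosureHistoryAutonomyMonotoneGeneral (memFlow_unique_of_monotone_zm)
open Summit.QuantumFields.BalabanUV.Beta.EriceRemainderEnclosureHistoryAutonomyComparisonNonlinearRowPrep (affine_facts)
open Summit.QuantumFields.BalabanUV.Beta.EriceRemainderEnclosureHistoryAutonomyComparisonNonlinearModulus (le_of_small_modulus_excess)

variable {γ β₀ β₁ : ℝ} {L L' : ℕ → ℝ} {K : ℕ}

/-- **THE INTERPOLATED MEMORIES.**  For `0 ≤ t ≤ t′` the memories `B_t u = (β₀ + t(β₁−β₀)) + Σ_k (L_k + t(L′_k − L_k))·u_k` (`β₀ ≤ β₁`, `L ≤ L′`, `L ≥ 0`) are affine with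
non-negative profiles, `B_t ≤ B_{t′}` on the box, the excess `B_{t′} − B_t` is isotone, and along ordered pairs it has modulus `(t′ − t)·Σ_k (L′_k − L_k)`. [folklore] -/
theorem affine_interp_facts (hL : ∀ k, 0 ≤ L k) (hLL' : ∀ k, L k ≤ L' k) (hββ' : β₀ ≤ β₁) {t t' : ℝ} (ht : 0 ≤ t) (htt' : t ≤ t') :
    (∀ k, 0 ≤ L k + t * (L' k - L k))
    ∧ (∀ u : ℕ → ℝ, SeqBox γ u →
        (β₀ + t * (β₁ - β₀)) + ∑ k ∈ range K, (L k + t * (L' k - L k)) * u k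
          ≤ (β₀ + t' * (β₁ - β₀)) + ∑ k ∈ range K, (L k + t' * (L' k - L k)) * u k)
    ∧ (∀ u v : ℕ → ℝ, SeqBox γ u → SeqBox γ v → (∀ j, u j ≤ v j) →
        ((β₀ + t' * (β₁ - β₀)) + ∑ k ∈ range K, (L k + t' * (L' k - L k)) * u k)
          - ((β₀ + t * (β₁ - β₀)) + ∑ k ∈ range K, (L k + t * (L' k - L k)) * u k)
        ≤ ((β₀ + t' * (β₁ - β₀)) + ∑ k ∈ range K, (L k + t' * (L' k - L k)) * v k)
          - ((β₀ + t * (β₁ - β₀)) + ∑ k ∈ range K, (L k + t * (L' k - L k)) * v k))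
    ∧ (∀ u u' : ℕ → ℝ, SeqBox γ u → SeqBox γ u' → (∀ j, u' j ≤ u j) → ∀ D : ℝ, 0 ≤ D → (∀ j, u j - u' j ≤ D) →
        (((β₀ + t' * (β₁ - β₀)) + ∑ k ∈ range K, (L k + t' * (L' k - L k)) * u k)
          - ((β₀ + t * (β₁ - β₀)) + ∑ k ∈ range K, (L k + t * (L' k - L k)) * u k))
        - (((β₀ + t' * (β₁ - β₀)) + ∑ k ∈ range K, (L k + t' * (L' k - L k)) * u' k)
          - ((β₀ + t * (β₁ - β₀)) + ∑ k ∈ range K, (L k + t * (L' k - L k)) * u' k))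
        ≤ ((t' - t) * ∑ k ∈ range K, (L' k - L k)) * D) := by
  have hd : ∀ k, 0 ≤ L' k - L k := fun k => sub_nonneg.mpr (hLL' k)
  have hdt : 0 ≤ t' - t := sub_nonneg.mpr htt'
  -- the excess as one sum
  have hexc : ∀ u : ℕ → ℝ, ((β₀ + t' * (β₁ - β₀)) + ∑ k ∈ range K, (L k + t' * (L' k - L k)) * u k)
      - ((β₀ + t * (β₁ - β₀)) + ∑ k ∈ range K, (L k + t * (L' k - L k)) * u k)
      = (t' - t) * (β₁ - β₀) + (t' - t) * ∑ k ∈ range K, (L' k - L k) * u k := by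
    intro u
    rw [mul_sum, ← sub_sub, add_sub_add_comm]
    have : ∑ k ∈ range K, (L k + t' * (L' k - L k)) * u k - ∑ k ∈ range K, (L k + t * (L' k - L k)) * u k
        = ∑ k ∈ range K, (t' - t) * ((L' k - L k) * u k) := by
      rw [← sum_sub_distrib]; exact sum_congr rfl fun k _ => by ring
    rw [add_sub_assoc] at *
    linarith [this]
  refine ⟨fun k => add_nonneg (hL k) (mul_nonneg ht (hd k)), fun u hu => ?_, fun u v hu hv hle => ?_, fun u u' hu hu' hle D hD hdiff => ?_⟩
  · have h1 := hexc u
    have : 0 ≤ (t' - t) * (β₁ - β₀) + (t' - t) * ∑ k ∈ range K, (L' k - L k) * u k :=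
      add_nonneg (mul_nonneg hdt (sub_nonneg.mpr hββ')) (mul_nonneg hdt (sum_nonneg fun k _ => mul_nonneg (hd k) (hu k).1.le))
    linarith
  · rw [hexc u, hexc v]
    have : ∑ k ∈ range K, (L' k - L k) * u k ≤ ∑ k ∈ range K, (L' k - L k) * v k :=
      sum_le_sum fun k _ => mul_le_mul_of_nonneg_left (hle k) (hd k)
    nlinarith [mul_le_mul_of_nonneg_left this hdt]
  · rw [hexc u, hexc u']
    have hs : ∑ k ∈ range K, (L' k - L k) * u k - ∑ k ∈ range K, (L' k - L k) * u' k ≤ (∑ k ∈ range K, (L' k - L k)) * D := by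
      rw [← sum_sub_distrib, sum_mul]
      exact sum_le_sum fun k _ => by rw [← mul_sub]; exact mul_le_mul_of_nonneg_left (hdiff k) (hd k)
    have := mul_le_mul_of_nonneg_left hs hdt
    nlinarith

/-- **THE AFFINE FLOW IS ANTITONE IN ALL ITS COEFFICIENTS (conjecture (E58′) for every affine isotone excess, at any size).**  `B u = β₀ + Σ_{k<K} L_k·u_k` and
`B′ u = β₁ + Σ_{k<K} L′_k·u_k` on the box ]0,γ] with `0 < β₀ ≤ β₁`, `0 ≤ L_k ≤ L′_k`, `L_0 = L′_0 = 0`; `h`, `h′` ANY box solutions of `B`, `B′` from one pin `p ∈ ]0,γ]`.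
Then `h′ ≤ h` at EVERY scale — by chaining (E119d) `le_of_small_modulus_excess` through `N` interpolated affine memories with `(Σ_k(L′_k − L_k))·γ ≤ N·β₀∕5`. [folklore] -/
theorem le_of_affine_le {B B' : (ℕ → ℝ) → ℝ} {p : ℝ} {h h' : ℕ → ℝ}
    (hBaff : ∀ u, SeqBox γ u → B u = β₀ + ∑ k ∈ range K, L k * u k) (hB'aff : ∀ u, SeqBox γ u → B' u = β₁ + ∑ k ∈ range K, L' k * u k)
    (hL : ∀ k, 0 ≤ L k) (hLL' : ∀ k, L k ≤ L' k) (hL0 : L 0 = 0) (hL'0 : L' 0 = 0) (hβ : 0 < β₀) (hββ' : β₀ ≤ β₁)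
    (hp : 0 < p) (hpγ : p ≤ γ) (hh : SeqBox γ h) (hf : MemFlow B p h) (hh' : SeqBox γ h') (hf' : MemFlow B' p h') (j : ℕ) :
    h' j ≤ h j := by
  have hγ : 0 < γ := hp.trans_le hpγ
  set ME : ℝ := ∑ k ∈ range K, (L' k - L k) with hME
  have hME0 : 0 ≤ ME := sum_nonneg fun k _ => sub_nonneg.mpr (hLL' k)
  -- the number of links
  obtain ⟨N, hN⟩ := exists_nat_ge (5 * ME * γ / β₀ + 1)
  have h5 : 0 ≤ 5 * ME * γ / β₀ := by positivity
  have hN1 : (1 : ℝ) ≤ N := by linarith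
  have hNpos : (0 : ℝ) < N := by linarith
  have hNnat : 1 ≤ N := by exact_mod_cast hN1
  -- the interpolated memories and their solutions from p
  set Bi : ℕ → (ℕ → ℝ) → ℝ := fun i u => (β₀ + ((i : ℝ) / N) * (β₁ - β₀)) + ∑ k ∈ range K, (L k + ((i : ℝ) / N) * (L' k - L k)) * u k
    with hBi
  have hti : ∀ i : ℕ, 0 ≤ (i : ℝ) / N := fun i => by positivity
  have hfacts : ∀ i : ℕ, (∀ k, 0 ≤ L k + ((i : ℝ) / N) * (L' k - L k)) := fun i =>
    (affine_interp_facts (γ := γ) (K := K) hL hLL' hββ' (hti i) le_rfl).1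
  have hβi : ∀ i : ℕ, 0 < β₀ + ((i : ℝ) / N) * (β₁ - β₀) := fun i =>
    lt_of_lt_of_le hβ (le_add_of_nonneg_right (mul_nonneg (hti i) (sub_nonneg.mpr hββ')))
  have hBiaff : ∀ i : ℕ, ∀ u, SeqBox γ u → Bi i u = (β₀ + ((i : ℝ) / N) * (β₁ - β₀)) + ∑ k ∈ range K, (L k + ((i : ℝ) / N) * (L' k - L k)) * u k :=
    fun i u _ => rfl
  have hex : ∀ i : ℕ, ∃ g : ℕ → ℝ, SeqBox γ g ∧ MemFlow (Bi i) p g := by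
    intro i
    obtain ⟨hmono, hlo, _, hmod⟩ := affine_facts (hBiaff i) (hfacts i) (hβi i)
    exact exists_memFlow_zm hmod (sum_nonneg fun k _ => hfacts i k) hp hpγ (hβi i) hlo
  choose g hgb hgf using hex
  -- consecutive members compare
  have hstep : ∀ i : ℕ, i < N → ∀ j, g (i + 1) j ≤ g i j := by
    intro i hi j
    have ht : (i : ℝ) / N ≤ ((i + 1 : ℕ) : ℝ) / N := by
      apply div_le_div_of_nonneg_right _ hNpos.le; push_cast; linarith
    obtain ⟨_, hexc, hDmono, hEmod⟩ := affine_interp_facts (γ := γ) (K := K) hL hLL' hββ' (hti i) ht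
    obtain ⟨_, _, _, hmod'⟩ := affine_facts (hBiaff (i + 1)) (hfacts (i + 1)) (hβi (i + 1))
    have hdt : ((i + 1 : ℕ) : ℝ) / N - (i : ℝ) / N = 1 / N := by push_cast; ring
    have hMEγ : (((i + 1 : ℕ) : ℝ) / N - (i : ℝ) / N) * ME * γ ≤ (β₀ + ((i : ℝ) / N) * (β₁ - β₀)) / 5 := by
      rw [hdt]
      have h1 : 1 / (N : ℝ) * ME * γ ≤ β₀ / 5 := by
        rw [show 1 / (N : ℝ) * ME * γ = ME * γ / N by ring, div_le_iff₀ hNpos]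
        have := (div_le_iff₀ hβ).mp (show 5 * ME * γ / β₀ ≤ (N : ℝ) - 1 by linarith)
        nlinarith
      have h2 : β₀ / 5 ≤ (β₀ + ((i : ℝ) / N) * (β₁ - β₀)) / 5 := by
        have := mul_nonneg (hti i) (sub_nonneg.mpr hββ'); linarith
      exact h1.trans h2
    have hL0i : L 0 + ((i : ℝ) / N) * (L' 0 - L 0) = 0 := by rw [hL0, hL'0]; ring
    have hMEi0 : 0 ≤ (((i + 1 : ℕ) : ℝ) / N - (i : ℝ) / N) * ME := mul_nonneg (by rw [hdt]; positivity) hME0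
    exact le_of_small_modulus_excess (B := Bi i) (B' := Bi (i + 1)) (γ := γ) (K := K) (ME := (((i + 1 : ℕ) : ℝ) / N - (i : ℝ) / N) * ME)
      (hBiaff i) (hfacts i) hL0i (hβi i) hmod' (sum_nonneg fun k _ => hfacts (i + 1) k)
      (fun u hu => hexc u hu) hDmono hEmod hMEi0 hMEγ hp hpγ (hgb i) (hgf i) (hgb (i + 1)) (hgf (i + 1)) j
  -- the chain
  have hchain : ∀ i : ℕ, i ≤ N → ∀ j, g i j ≤ g 0 j := by
    intro i
    induction i with
    | zero => intro _ j; exact le_rfl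
    | succ i ih => intro hi j; exact (hstep i (by omega) j).trans (ih (by omega) j)
  -- the ends: h = g 0, h′ = g N (uniqueness)
  obtain ⟨hmono0, hlo0, _, hmod0⟩ := affine_facts (hBiaff 0) (hfacts 0) (hβi 0)
  obtain ⟨hmonoN, hloN, _, hmodN⟩ := affine_facts (hBiaff N) (hfacts N) (hβi N)
  have hB0 : ∀ u, SeqBox γ u → B u = Bi 0 u := fun u hu => by
    rw [hBaff u hu, hBiaff 0 u hu]; simp
  have hBN : ∀ u, SeqBox γ u → B' u = Bi N u := fun u hu => by
    rw [hB'aff u hu, hBiaff N u hu, div_self hNpos.ne']; congr 1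
    · ring
    · exact sum_congr rfl fun k _ => by ring
  have hf0 : MemFlow (Bi 0) p h := ⟨hf.1, fun m => by rw [← hB0 _ (seqBox_shift hh (m + 1))]; exact hf.2 m⟩
  have hfN : MemFlow (Bi N) p h' := ⟨hf'.1, fun m => by rw [← hBN _ (seqBox_shift hh' (m + 1))]; exact hf'.2 m⟩
  have e0 : h = g 0 := memFlow_unique_of_monotone_zm hmono0 hmod0 (sum_nonneg fun k _ => hfacts 0 k) hp (hβi 0) hlo0 hh (hgb 0) hf0 (hgf 0)
  have eN : h' = g N := memFlow_unique_of_monotone_zm hmonoN hmodN (sum_nonneg fun k _ => hfacts N k) hp (hβi N) hloN hh' (hgb N) hfN (hgf N)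
  rw [e0, eN]
  exact hchain N le_rfl j

end Summit.QuantumFields.BalabanUV.Beta.EriceRemainderEnclosureHistoryAutonomyComparisonAffineMonotone

end
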